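import Summits.CriticalPhenomena.PercolationContinuityZ3.Theorems.PercNearOneGluingNoHeavyLowerTailCILSharpHardnessHub
import HarnessLib

/-!
# `NoHeavyLowerTail` (stmt-CriticalPhenomena-4575) — CALIBRATION: the PRODUCT and TOP-WEIGHTED forms of
# cumulative isolation imply Kozma–Nitzan's Conjecture 1

Seat `prim-gen-swap` (gen 3), 2026-08-18.  `μ = prodBernoulli w` on `Fin n`, relays `A`, level `j`,
`π(v) = {z ∈ A : v ↔ z}`, `R_v = {|π(v)| ≤ j}` ("`v` is lonely"), `L = {1 ≤ |π(o)| ≤ j}`, and a champion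
`c ∈ argmax_{a ∈ A} μ(R_a)`.  Plain cumulative isolation is `CIL : μ(L) ≤ μ(R_c)` (registered
`stub_cumulativeIsolation`; it closes the crux, `Theorems.noHeavyLowerTail_of_stub_cumulativeIsolation`).  Two
sharpenings found numerically exact in this seat's lineage (gens 1–2, reports `MAX-TRANSFER.md`, `ASSEMBLY-LP.md`;
0 failures in ≈ 2·10¹⁰ exhaustive tests) were proposed there as "the universal form to aim at":

* the PRODUCT form  `CIL' :  μ(o ↔ A) · μ(R_cᶜ) ≤ μ(R_oᶜ)`  ("given that `o` meets the relay set at all, it lies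
  in a big block at least as often as the champion does"), and
* the TOP-WEIGHTED form  `U :  μ(L) ≤ E[max_{x ∈ π(o)} μ(R_x) ; π(o) ≠ ∅]`  (gen 1's inequality "U"; at the
  half level `j = ⌊|A|/2⌋` it is the covariance form `Σ_x Cov(1{top(B_o) = x}, 1{x ∈ giant}) ≥ 0` of gen 2,
  and it is implied by the prefix inequalities "PBCR" of gen 1).

`U ⇒ CIL' ⇒ CIL` trivially (`productIsolation_of_topWeighted`, `cumulativeIsolation_of_productIsolation`).
**This file proves that `CIL'` — even restricted to the exact half level `|A| = 2j + 1` — implies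
Kozma–Nitzan's Conjecture 1** [KozmaNitzan2024, (1) p. 3: `P(0 ↔ b) ≥ P(0 ↔ A)·min_{a∈A} P(a ↔ b)`, the
summit's strong hypothesis `KozmaNitzan2024_conjecture1`, which gives `θ(p_c) = 0` on `ℤ^d` by KN Thm 6]
(`kozmaNitzan_conjecture1_of_productIsolation`), hence so does `U` (`kozmaNitzan_conjecture1_of_topWeighted`).
So `CIL'`, `U`, PBCR and the covariance form are statements at least as strong as the open post-FKG conjecture
and are NOT intermediate targets for the crux (which is Conjecture 3, strictly downstream of Conjecture 1);
this complements gen 1's `kozmaNitzan_conjecture1_of_cilSharp` (`CIL♯ ⇒` Conjecture 2).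

HUB TRANSFER (as in `…CILSharpHardness.lean`, [KozmaNitzan2024, Thm 10 proof sketch, p. 32]): given
`(G, A, o, b)` add `k = |A| + 1` hubs glued to `b` (`…CILSharpHardnessHub.lean`), relay set `A' = A ∪ {hubs}`
(`|A'| = 2|A| + 1`), level `j = |A|`.  Almost surely `R'_v = {v ↮ b}` for old `v`, hubs are never lonely, the
champion of `A'` is the relay `a₀ ∈ A` least connected to `b`, and `{o ↔ A'} = {o ↔ A} ∪ {o ↔ b}`; `CIL'` for
`(A', j)` reads `μ({o ↔ A} ∪ {o ↔ b}) · μ(a₀ ↔ b) ≤ μ(o ↔ b)`, which contains Conjecture 1 (no Harris needed).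
-/

noncomputable section

namespace Summit.CriticalPhenomena.PercolationContinuityZ3.Theorems

open MeasureTheory Set Literature.Probability.LatticeModels Literature.Probability.Percolation
open scoped Classical BigOperators NNReal

open CILSharpHardness

namespace TopWeightHardness

variable {n : ℕ}

/-- `|A'| = |A| + k` for the relay set of the hub graph. [folklore] -/
theorem card_relays' (A : Finset (Fin n)) (k : ℕ) :
    (A.map ⟨Fin.castAdd k, Fin.castAdd_injective _ _⟩ ∪
      (Finset.univ : Finset (Fin k)).map ⟨Fin.natAdd n, Fin.natAdd_injective _ _⟩).card = A.card + k := by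
  rw [Finset.card_union_of_disjoint, Finset.card_map, Finset.card_map, Finset.card_univ, Fintype.card_fin]
  rw [Finset.disjoint_left]
  intro z hz1 hz2
  rw [Finset.mem_map] at hz1 hz2
  obtain ⟨a, _, rfl⟩ := hz1
  obtain ⟨i, _, hi⟩ := hz2
  exact castAdd_ne_natAdd a i hi.symm

/-- `{o ↔ A}` is the disjoint union of `L = {1 ≤ |π(o)| ≤ j}` and `R_oᶜ = {|π(o)| > j}`:
`μ(o ↔ A) = μ(L) + μ(R_oᶜ)`. [folklore] -/
theorem real_join_eq (w : Sym2 (Fin n) → unitInterval) (A : Finset (Fin n)) (o : Fin n) (j : ℕ) :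
    (prodBernoulli w).real {ω : BondConfig (Fin n) | ∃ b ∈ A, ω ∈ openConn o b} =
      (prodBernoulli w).real {ω : BondConfig (Fin n) |
          1 ≤ (A.filter fun z => ω ∈ openConn o z).card ∧ (A.filter fun z => ω ∈ openConn o z).card ≤ j} +
        (prodBernoulli w).real {ω : BondConfig (Fin n) | (A.filter fun z => ω ∈ openConn o z).card ≤ j}ᶜ := by
  have hmeas : ∀ S : Set (BondConfig (Fin n)), MeasurableSet S := fun S => (Set.toFinite S).measurableSet
  rw [← measureReal_union _ (hmeas _)]
  · congr 1
    ext ω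
    simp only [mem_setOf_eq, mem_union, mem_compl_iff, not_le]
    constructor
    · rintro ⟨b, hb, hob⟩
      have h1 : 1 ≤ (A.filter fun z => ω ∈ openConn o z).card :=
        Finset.card_pos.2 ⟨b, Finset.mem_filter.2 ⟨hb, hob⟩⟩
      by_cases h : (A.filter fun z => ω ∈ openConn o z).card ≤ j
      · exact Or.inl ⟨h1, h⟩
      · exact Or.inr (not_le.1 h)
    · rintro (⟨h1, _⟩ | h)
      · obtain ⟨b, hb⟩ := Finset.card_pos.1 h1
        exact ⟨b, (Finset.mem_filter.1 hb).1, (Finset.mem_filter.1 hb).2⟩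
      · obtain ⟨b, hb⟩ := Finset.card_pos.1 (lt_of_le_of_lt (Nat.zero_le j) h)
        exact ⟨b, (Finset.mem_filter.1 hb).1, (Finset.mem_filter.1 hb).2⟩
  · rw [Set.disjoint_left]
    rintro ω ⟨_, h2⟩ h3
    exact h3 h2

/-- `μ(o ↔ A) = Σ_{∅ ≠ S ⊆ A} μ(π(o) = S)`. [folklore] -/
theorem real_join_eq_sum (w : Sym2 (Fin n) → unitInterval) (A : Finset (Fin n)) (o : Fin n) :
    (prodBernoulli w).real {ω : BondConfig (Fin n) | ∃ b ∈ A, ω ∈ openConn o b} =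
      ∑ S ∈ A.powerset.erase ∅,
        (prodBernoulli w).real {ω : BondConfig (Fin n) | (A.filter fun z => ω ∈ openConn o z) = S} := by
  have hmeas : ∀ S : Set (BondConfig (Fin n)), MeasurableSet S := fun S => (Set.toFinite S).measurableSet
  rw [← measureReal_biUnion_finset _ fun S _ => hmeas _]
  · congr 1
    ext ω
    simp only [mem_setOf_eq, mem_iUnion, Finset.mem_erase, Finset.mem_powerset, exists_prop]
    constructor
    · rintro ⟨b, hb, hob⟩
      refine ⟨A.filter fun z => ω ∈ openConn o z, ⟨?_, Finset.filter_subset _ _⟩, rfl⟩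
      exact Finset.nonempty_iff_ne_empty.1 ⟨b, Finset.mem_filter.2 ⟨hb, hob⟩⟩
    · rintro ⟨S, ⟨hS, _⟩, hSe⟩
      obtain ⟨b, hb⟩ := Finset.nonempty_iff_ne_empty.2 hS
      rw [← hSe] at hb
      exact ⟨b, (Finset.mem_filter.1 hb).1, (Finset.mem_filter.1 hb).2⟩
  · intro S _ S' _ hne
    rw [Function.onFun, Set.disjoint_left]
    intro ω h1 h2
    rw [mem_setOf_eq] at h1 h2
    exact hne (h1.symm.trans h2)

end TopWeightHardness

open TopWeightHardness

variable {n : ℕ}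

/-- **`CIL' ⇒` Kozma–Nitzan Conjecture 1.**  If the PRODUCT form of cumulative isolation
`μ(o ↔ A)·μ(R_cᶜ) ≤ μ(R_oᶜ)` holds on every finite weighted graph at the exact half level `|A| = 2j + 1` for a
champion `c`, then for every `(G, A, o, b)` and every `t ≤ min_{a ∈ A} μ(a ↔ b)`:
`μ(o ↔ A)·t ≤ μ(o ↔ b)` (the min-free typing of `KozmaNitzan2024_conjecture1`).  Hub transfer, module docstring. -/
theorem kozmaNitzan_conjecture1_of_productIsolation
    (hP : ∀ (n : ℕ) (w : Sym2 (Fin n) → unitInterval) (A : Finset (Fin n)) (o c : Fin n) (j : ℕ),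
      o ∉ A → c ∈ A → 2 * j + 1 = A.card →
      (∀ a ∈ A,
        (Literature.Probability.LatticeModels.prodBernoulli w).real
            {ω : Literature.Probability.Percolation.BondConfig (Fin n) |
              (A.filter fun z => ω ∈ Literature.Probability.Percolation.openConn a z).card ≤ j} ≤
          (Literature.Probability.LatticeModels.prodBernoulli w).real
            {ω : Literature.Probability.Percolation.BondConfig (Fin n) |
              (A.filter fun z => ω ∈ Literature.Probability.Percolation.openConn c z).card ≤ j}) →
      (Literature.Probability.LatticeModels.prodBernoulli w).real
          {ω : Literature.Probability.Percolation.BondConfig (Fin n) |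
            ∃ b ∈ A, ω ∈ Literature.Probability.Percolation.openConn o b} *
        (Literature.Probability.LatticeModels.prodBernoulli w).real
          {ω : Literature.Probability.Percolation.BondConfig (Fin n) |
            (A.filter fun z => ω ∈ Literature.Probability.Percolation.openConn c z).card ≤ j}ᶜ ≤
      (Literature.Probability.LatticeModels.prodBernoulli w).real
          {ω : Literature.Probability.Percolation.BondConfig (Fin n) |
            (A.filter fun z => ω ∈ Literature.Probability.Percolation.openConn o z).card ≤ j}ᶜ) :
    ∀ (n : ℕ) (w : Sym2 (Fin n) → unitInterval) (A : Finset (Fin n)) (o b : Fin n) (t : ℝ),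
      (∀ a ∈ A, t ≤ (prodBernoulli w).real (openConn a b)) →
        (prodBernoulli w).real (⋃ a ∈ A, openConn o a) * t ≤ (prodBernoulli w).real (openConn o b) := by
  intro n w A o b t ht
  set μ := prodBernoulli w with hμ
  have hmeas : ∀ S : Set (BondConfig (Fin n)), MeasurableSet S := fun S => (Set.toFinite S).measurableSet
  rcases A.eq_empty_or_nonempty with hA | hA
  · subst hA
    simp only [Finset.notMem_empty, iUnion_of_empty, iUnion_empty, measureReal_empty, zero_mul]
    exact measureReal_nonneg
  by_cases ht0 : t < 0
  · exact le_trans (mul_nonpos_of_nonneg_of_nonpos measureReal_nonneg ht0.le) measureReal_nonneg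
  push Not at ht0
  -- trivial case `o ∈ A`
  by_cases hoA : o ∈ A
  · calc μ.real (⋃ a ∈ A, openConn o a) * t ≤ 1 * μ.real (openConn o b : Set (BondConfig (Fin n))) :=
          mul_le_mul measureReal_le_one (ht o hoA) ht0 zero_le_one
      _ = μ.real (openConn o b) := one_mul _
  -- the relay least connected to `b`
  obtain ⟨a₀, ha₀, hmin⟩ := Finset.exists_min_image A (fun a => μ.real (openConn a b : Set (BondConfig (Fin n)))) hA
  -- the hub graph
  set k : ℕ := A.card + 1 with hk
  obtain ⟨w', hw, h1, h0⟩ := exists_hubWeight w b k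
  set μ' := prodBernoulli w' with hμ'
  set A' : Finset (Fin (n + k)) := (A.map ⟨Fin.castAdd k, Fin.castAdd_injective _ _⟩ ∪
      (Finset.univ : Finset (Fin k)).map ⟨Fin.natAdd n, Fin.natAdd_injective _ _⟩) with hA'
  have transport := real_eq_of_good w b k w' hw h1 h0
  have hoA' : Fin.castAdd k o ∉ A' := by
    rw [hA', mem_relays'_iff]
    rintro (⟨a, ha, hao⟩ | ⟨i, hi⟩)
    · exact hoA (Fin.castAdd_injective _ _ hao ▸ ha)
    · exact castAdd_ne_natAdd o i hi.symm
  have ha₀A' : Fin.castAdd k a₀ ∈ A' := (mem_relays'_iff A _).2 (Or.inl ⟨a₀, ha₀, rfl⟩)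
  have hcard : 2 * A.card + 1 = A'.card := by rw [hA', card_relays' A k, hk]; ring
  -- loneliness events on the hub graph, transported: `R'_v = {v ↮ b}` for old `v`, `R'_{h_i} = ∅`
  have hR : ∀ v : Fin n, μ'.real {ω' : BondConfig (Fin (n + k)) |
      (A'.filter fun z => ω' ∈ openConn (Fin.castAdd k v) z).card ≤ A.card} =
      μ.real (openConn v b : Set (BondConfig (Fin n)))ᶜ := by
    intro v
    refine transport _ _ fun ω' hω => ?_
    rw [mem_setOf_eq, card_filter_relays' hω A v, mem_compl_iff]
    constructor
    · intro h hvb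
      rw [if_pos hvb] at h
      omega
    · intro hvb
      rw [if_neg hvb, add_zero]
      exact Finset.card_filter_le _ _
  have hRc : ∀ v : Fin n, μ'.real {ω' : BondConfig (Fin (n + k)) |
      (A'.filter fun z => ω' ∈ openConn (Fin.castAdd k v) z).card ≤ A.card}ᶜ =
      μ.real (openConn v b : Set (BondConfig (Fin n))) := by
    intro v
    refine transport _ _ fun ω' hω => ?_
    rw [mem_compl_iff, mem_setOf_eq, card_filter_relays' hω A v, not_le]
    constructor
    · intro h
      by_contra hvb
      rw [if_neg hvb, add_zero] at h
      exact absurd (Finset.card_filter_le A fun z => restrictConfig (Fin.castAdd k) ω' ∈ openConn v z)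
        (not_le.2 h)
    · intro hvb
      rw [if_pos hvb]
      omega
  have hRhub : ∀ i : Fin k, μ'.real {ω' : BondConfig (Fin (n + k)) |
      (A'.filter fun z => ω' ∈ openConn (Fin.natAdd n i) z).card ≤ A.card} = 0 := by
    intro i
    rw [transport _ (∅ : Set (BondConfig (Fin n))) fun ω' hω => ?_, measureReal_empty]
    simp only [mem_setOf_eq, mem_empty_iff_false, iff_false, not_le]
    have := card_filter_relays'_natAdd hω A i
    rw [← hA'] at this
    omega
  -- `a₀` is a champion of `A'`
  have hchamp : ∀ z ∈ A', μ'.real {ω' : BondConfig (Fin (n + k)) |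
      (A'.filter fun z' => ω' ∈ openConn z z').card ≤ A.card} ≤
      μ'.real {ω' : BondConfig (Fin (n + k)) |
        (A'.filter fun z' => ω' ∈ openConn (Fin.castAdd k a₀) z').card ≤ A.card} := by
    intro z hz
    rw [hR a₀]
    rcases (mem_relays'_iff A z).1 hz with ⟨a, ha, rfl⟩ | ⟨i, rfl⟩
    · rw [hR a, probReal_compl_eq_one_sub (hmeas _), probReal_compl_eq_one_sub (hmeas _)]
      linarith [hmin a ha]
    · rw [hRhub i]; exact measureReal_nonneg
  have key := hP (n + k) w' A' (Fin.castAdd k o) (Fin.castAdd k a₀) A.card hoA' ha₀A' hcard hchamp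
  -- identify the sides
  set U : Set (BondConfig (Fin n)) := ⋃ a' ∈ A, openConn o a' with hU
  set B₀ : Set (BondConfig (Fin n)) := openConn o b with hB₀
  have hreach : ∀ ω', ((∀ i : Fin k, s(Fin.castAdd k b, Fin.natAdd n i) ∈ ω') ∧
      ∀ e' ∈ ω', (∃ e : Sym2 (Fin n), Sym2.map (Fin.castAdd k) e = e') ∨
        ∃ i : Fin k, e' = s(Fin.castAdd k b, Fin.natAdd n i)) →
      ((∃ z ∈ A', ω' ∈ openConn (Fin.castAdd k o) z) ↔
      restrictConfig (Fin.castAdd k) ω' ∈ U ∪ B₀) := by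
    intro ω' hω
    rw [hU, hB₀, mem_union, mem_iUnion₂]
    constructor
    · rintro ⟨z, hz, hoz⟩
      rcases (mem_relays'_iff A z).1 hz with ⟨a, ha, rfl⟩ | ⟨i, rfl⟩
      · exact Or.inl ⟨a, ha, (reachable_castAdd_iff hω o a).1 hoz⟩
      · exact Or.inr ((reachable_natAdd_iff hω o i).1 hoz)
    · rintro (⟨a, ha, hoa⟩ | hob)
      · exact ⟨Fin.castAdd k a, (mem_relays'_iff A _).2 (Or.inl ⟨a, ha, rfl⟩),
          (reachable_castAdd_iff hω o a).2 hoa⟩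
      · have hk1 : 0 < k := by rw [hk]; omega
        exact ⟨Fin.natAdd n ⟨0, hk1⟩, (mem_relays'_iff A _).2 (Or.inr ⟨⟨0, hk1⟩, rfl⟩),
          (reachable_natAdd_iff hω o ⟨0, hk1⟩).2 hob⟩
  have hJ : μ'.real {ω' : BondConfig (Fin (n + k)) | ∃ z ∈ A', ω' ∈ openConn (Fin.castAdd k o) z} =
      μ.real (U ∪ B₀) := transport _ _ fun ω' hω => by rw [mem_setOf_eq, hreach ω' hω]
  rw [hJ, hRc a₀, hRc o] at key
  -- `μ(U)·t ≤ μ(U ∪ B₀)·μ(a₀ ↔ b) ≤ μ(o ↔ b)`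
  calc μ.real U * t ≤ μ.real (U ∪ B₀) * μ.real (openConn a₀ b : Set (BondConfig (Fin n))) :=
        mul_le_mul (measureReal_mono subset_union_left) (ht a₀ ha₀) ht0 measureReal_nonneg
    _ ≤ μ.real B₀ := key

/-- **`U ⇒ CIL'`.**  The TOP-WEIGHTED form `μ(L) ≤ Σ_{∅ ≠ S ⊆ A} μ(π(o) = S)·max_{x ∈ S} μ(R_x)`
(`= E[max_{x ∈ π(o)} μ(R_x); π(o) ≠ ∅]`; the `S = ∅` term vanishes) implies the product form
`μ(o ↔ A)·μ(R_cᶜ) ≤ μ(R_oᶜ)` for a champion `c`, on the same graph, relay set and level: bound every maximum by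
`μ(R_c)` and use `μ(o ↔ A) = μ(L) + μ(R_oᶜ)`, `μ(R_cᶜ) = 1 − μ(R_c)`. -/
theorem productIsolation_of_topWeighted (w : Sym2 (Fin n) → unitInterval) (A : Finset (Fin n))
    (o c : Fin n) (j : ℕ)
    (hmax : ∀ a ∈ A,
      (prodBernoulli w).real {ω : BondConfig (Fin n) | (A.filter fun z => ω ∈ openConn a z).card ≤ j} ≤
        (prodBernoulli w).real {ω : BondConfig (Fin n) | (A.filter fun z => ω ∈ openConn c z).card ≤ j})
    (hU : (prodBernoulli w).real {ω : BondConfig (Fin n) |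
        1 ≤ (A.filter fun z => ω ∈ openConn o z).card ∧ (A.filter fun z => ω ∈ openConn o z).card ≤ j} ≤
      ∑ S ∈ A.powerset,
        (prodBernoulli w).real {ω : BondConfig (Fin n) | (A.filter fun z => ω ∈ openConn o z) = S} *
          ((S.sup fun x => ((prodBernoulli w).real
            {ω : BondConfig (Fin n) | (A.filter fun z => ω ∈ openConn x z).card ≤ j}).toNNReal : ℝ≥0) : ℝ)) :
    (prodBernoulli w).real {ω : BondConfig (Fin n) | ∃ b ∈ A, ω ∈ openConn o b} *
        (prodBernoulli w).real {ω : BondConfig (Fin n) | (A.filter fun z => ω ∈ openConn c z).card ≤ j}ᶜ ≤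
      (prodBernoulli w).real {ω : BondConfig (Fin n) | (A.filter fun z => ω ∈ openConn o z).card ≤ j}ᶜ := by
  set μ := prodBernoulli w with hμ
  have hmeas : ∀ S : Set (BondConfig (Fin n)), MeasurableSet S := fun S => (Set.toFinite S).measurableSet
  set r : Fin n → ℝ := fun x => μ.real {ω : BondConfig (Fin n) | (A.filter fun z => ω ∈ openConn x z).card ≤ j}
    with hr
  set q : Finset (Fin n) → ℝ := fun S => μ.real {ω : BondConfig (Fin n) | (A.filter fun z => ω ∈ openConn o z) = S}
    with hq
  have hrc0 : 0 ≤ r c := measureReal_nonneg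
  -- every term of the sum is at most `q(S)·r(c)`, and the `S = ∅` term vanishes
  have hterm : ∀ S ∈ A.powerset, q S * ((S.sup fun x => (r x).toNNReal : ℝ≥0) : ℝ) ≤
      (if S = ∅ then 0 else q S * r c) := by
    intro S hS
    by_cases hSe : S = ∅
    · subst hSe
      simp only [Finset.sup_empty, bot_eq_zero', NNReal.coe_zero, mul_zero, if_true, le_refl]
    · rw [if_neg hSe]
      refine mul_le_mul_of_nonneg_left ?_ measureReal_nonneg
      have hsup : (S.sup fun x => (r x).toNNReal) ≤ (r c).toNNReal :=
        Finset.sup_le fun x hx => Real.toNNReal_le_toNNReal (hmax x (Finset.mem_powerset.1 hS hx))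
      calc ((S.sup fun x => (r x).toNNReal : ℝ≥0) : ℝ) ≤ ((r c).toNNReal : ℝ) := NNReal.coe_le_coe.2 hsup
        _ = r c := Real.coe_toNNReal _ hrc0
  have hsum : ∑ S ∈ A.powerset, q S * ((S.sup fun x => (r x).toNNReal : ℝ≥0) : ℝ) ≤
      r c * μ.real {ω : BondConfig (Fin n) | ∃ b ∈ A, ω ∈ openConn o b} := by
    calc ∑ S ∈ A.powerset, q S * ((S.sup fun x => (r x).toNNReal : ℝ≥0) : ℝ)
        ≤ ∑ S ∈ A.powerset, (if S = ∅ then 0 else q S * r c) := Finset.sum_le_sum hterm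
      _ = ∑ S ∈ A.powerset.erase ∅, (if S = ∅ then 0 else q S * r c) :=
          (Finset.sum_erase _ (by rw [if_pos rfl])).symm
      _ = ∑ S ∈ A.powerset.erase ∅, q S * r c :=
          Finset.sum_congr rfl fun S hS => if_neg (Finset.ne_of_mem_erase hS)
      _ = r c * ∑ S ∈ A.powerset.erase ∅, q S := by rw [Finset.mul_sum]; exact Finset.sum_congr rfl fun S _ => mul_comm _ _
      _ = r c * μ.real {ω : BondConfig (Fin n) | ∃ b ∈ A, ω ∈ openConn o b} := by
          rw [hq, ← real_join_eq_sum w A o]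
  have hjoin := real_join_eq w A o j
  have hcompl : μ.real {ω : BondConfig (Fin n) | (A.filter fun z => ω ∈ openConn c z).card ≤ j}ᶜ = 1 - r c :=
    probReal_compl_eq_one_sub (hmeas _)
  rw [hcompl]
  have hL := hU.trans hsum
  -- `μ(J) - μ(R_oᶜ) = μ(L) ≤ r c · μ(J)`
  nlinarith [hL, hjoin, measureReal_nonneg (μ := μ)
    (s := {ω : BondConfig (Fin n) | ∃ b ∈ A, ω ∈ openConn o b})]

/-- **`U ⇒` Kozma–Nitzan Conjecture 1**: the top-weighted form of cumulative isolation (gen 1's "U", gen 2's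
covariance form `Σ_x Cov(1{top(B_o)=x}, 1{x ∈ giant}) ≥ 0`), assumed on every finite weighted graph at the
exact half level `|A| = 2j + 1`, implies the post-FKG conjecture. -/
theorem kozmaNitzan_conjecture1_of_topWeighted
    (hT : ∀ (n : ℕ) (w : Sym2 (Fin n) → unitInterval) (A : Finset (Fin n)) (o : Fin n) (j : ℕ),
      o ∉ A → 2 * j + 1 = A.card →
      (Literature.Probability.LatticeModels.prodBernoulli w).real
          {ω : Literature.Probability.Percolation.BondConfig (Fin n) |
            1 ≤ (A.filter fun z => ω ∈ Literature.Probability.Percolation.openConn o z).card ∧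
              (A.filter fun z => ω ∈ Literature.Probability.Percolation.openConn o z).card ≤ j} ≤
        ∑ S ∈ A.powerset,
          (Literature.Probability.LatticeModels.prodBernoulli w).real
              {ω : Literature.Probability.Percolation.BondConfig (Fin n) |
                (A.filter fun z => ω ∈ Literature.Probability.Percolation.openConn o z) = S} *
            ((S.sup fun x => ((Literature.Probability.LatticeModels.prodBernoulli w).real
              {ω : Literature.Probability.Percolation.BondConfig (Fin n) |
                (A.filter fun z => ω ∈ Literature.Probability.Percolation.openConn x z).card ≤ j}).toNNReal :
                  ℝ≥0) : ℝ)) :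
    ∀ (n : ℕ) (w : Sym2 (Fin n) → unitInterval) (A : Finset (Fin n)) (o b : Fin n) (t : ℝ),
      (∀ a ∈ A, t ≤ (prodBernoulli w).real (openConn a b)) →
        (prodBernoulli w).real (⋃ a ∈ A, openConn o a) * t ≤ (prodBernoulli w).real (openConn o b) :=
  kozmaNitzan_conjecture1_of_productIsolation fun n w A o c j hoA _ hcard hmax =>
    productIsolation_of_topWeighted w A o c j hmax (hT n w A o j hoA hcard)

/-- **`CIL' ⇒ CIL`** on the same graph, relay set and level: the product form implies plain cumulative isolation
`μ(L) ≤ μ(R_c)` (so `CIL'` sits between `CIL♯` — which implies it by Harris — and the registered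
`stub_cumulativeIsolation`). -/
theorem cumulativeIsolation_of_productIsolation (w : Sym2 (Fin n) → unitInterval) (A : Finset (Fin n))
    (o c : Fin n) (j : ℕ)
    (hP : (prodBernoulli w).real {ω : BondConfig (Fin n) | ∃ b ∈ A, ω ∈ openConn o b} *
        (prodBernoulli w).real {ω : BondConfig (Fin n) | (A.filter fun z => ω ∈ openConn c z).card ≤ j}ᶜ ≤
      (prodBernoulli w).real {ω : BondConfig (Fin n) | (A.filter fun z => ω ∈ openConn o z).card ≤ j}ᶜ) :
    (prodBernoulli w).real {ω : BondConfig (Fin n) |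
        1 ≤ (A.filter fun z => ω ∈ openConn o z).card ∧ (A.filter fun z => ω ∈ openConn o z).card ≤ j} ≤
      (prodBernoulli w).real {ω : BondConfig (Fin n) | (A.filter fun z => ω ∈ openConn c z).card ≤ j} := by
  set μ := prodBernoulli w with hμ
  have hmeas : ∀ S : Set (BondConfig (Fin n)), MeasurableSet S := fun S => (Set.toFinite S).measurableSet
  have hjoin := real_join_eq w A o j
  have hcompl : μ.real {ω : BondConfig (Fin n) | (A.filter fun z => ω ∈ openConn c z).card ≤ j}ᶜ =
      1 - μ.real {ω : BondConfig (Fin n) | (A.filter fun z => ω ∈ openConn c z).card ≤ j} :=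
    probReal_compl_eq_one_sub (hmeas _)
  rw [hcompl] at hP
  have hJ1 : μ.real {ω : BondConfig (Fin n) | ∃ b ∈ A, ω ∈ openConn o b} ≤ 1 := measureReal_le_one
  have hRc0 : 0 ≤ μ.real {ω : BondConfig (Fin n) | (A.filter fun z => ω ∈ openConn c z).card ≤ j} :=
    measureReal_nonneg
  nlinarith [hP, hjoin, hJ1, hRc0]

end Summit.CriticalPhenomena.PercolationContinuityZ3.Theorems

end
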